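import Mathlib
import HarnessLib
import HarnessLib.Audit
import Summits.KontsevichZagierPeriods.Statement

/-!
Route: SeparabilityScissors

CLOSED (retired) 2026-08-15T13:48:36Z by operator:999:1257524 — reason: not-a-thesis: assembly does not conclude the sub-problem Statement — note: D-0027 §2.1 audit (human 2026-08-15: routes that do not decide the summit are removed): the assembly concludes `Target`, not the sub-problem statement; a NEW conforming route may be opened from the same idea (generated `closes : … → _root_.KontsevichZagierPeriods`).. The file is kept as the record of this route; refuted decls are indexed as negative knowledge (`ledger negatives`).

# Route SeparabilityScissors — 29/64 and 8/33 by cut-and-paste — separability probabilities as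
Conjecture-1 instances between spectrahedra; the crux is the central-symmetry core of the
maximally-mixed-marginal fibre

X = Target = Rebit2964 ∧ Qubit833 ("it suffices to show X" for the SEPARABILITY SECTOR of Conjecture
1; card
entanglement-29-64-8-33-spectrahedral-scissors). Rebit2964: the 9-dimensional spectrahedron D_ℝ of
two-rebit states (real symmetric
ρ ≽ 0, Tr ρ = 1, affine chart) and its PPT sub-body P_ℝ = {ρ ∈ D_ℝ : ρ^Γ ≽ 0} satisfy [P_ℝ, 64] ~
[D_ℝ, 29] under the moves of the H21
calculus (value equality = the Lovas–Andai theorem P_sep(ℝ) = 29/64, LovasAndai2017 Thm 2).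
Qubit833: the 15-dimensional two-qubit body
D_ℂ and its PPT (= separable, Peres–Horodecki) sub-body satisfy [P_ℂ, 33] ~ [D_ℂ, 8] (value equality
= 8/33, conjectured by Slater
since 2007, PROVED by Huong–Khoi 2024, re-derived via Duistermaat–Heckman by Zhang–Jiang–Xie 2025).
Both are pairs of KZ-RATIONAL
representations of the literal §1.1 shape (polynomial PSD inequalities with integer coefficients,
constant integrands) with equal
values, hence literal instances of the summit. The route's reduction: by the reduction criterion (=
PPT for qubits) the PPT body is
D ∩ τD for the LINEAR INVOLUTION τρ = 1⊗Tr₁ρ − ρ, which on each marginal fibre {Tr₁ρ = ρ_B} is the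
point reflection through ½·1⊗ρ_B;
by Milz–Strunz/Lovas–Andai invariance (one congruence change of variables) everything transports to
the maximally-mixed-marginal fibre
K = {ρ ≽ 0, Tr₁ρ = 1/2}, where PPT = K ∩ (½·1 − K) is the CENTRAL-SYMMETRY CORE of the 12-dim (resp.
7-dim) spectrahedron K about the
maximally mixed state. The ranked cruxes are the two fibre instances (QubitCore833, RebitCore2964),
Slater's pointwise defect identity
(DefectPoly) and the transport (Transport).
Lean: `Target` where `Target := `(∀ (ρ ρ' : (Fin 9 → ℝ) → Matrix (Fin 4) (Fin 4) ℝ), (∀ y, ρ y =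
!![y 0, y 2, y 5, y 6; y 2, y 1, y 7, y 8; y 5, y 7, y 3, y 4; y 6, y 8, y 4, 1 - y 0 - y 1 - y 3])
→ (∀ y, ρ' y = !![y 0, y 2, y 5, y 7; y 2, y 1, y 6, y 8; y 5, y 6, y 3, y 4; y 7, y 8, y 4, 1 - y 0
- y 1 - y 3]) → ∀ (r r' : Literature.NumberTheory.Transcendental.KZ.IntegralRep 9), r.domain = {y |
(ρ y).PosSemidef ∧ (ρ' y).PosSemidef} → Set.EqOn r.integrand (fun _ => 64) r.domain → r'.domain = {y
| (ρ y).PosSemidef} → Set.EqOn r'.integrand (fun _ => 29) r'.domain →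
Literature.NumberTheory.Transcendental.KZ.Equivalent r r') ∧ (open scoped ComplexOrder in ∀ (ρ ρ' :
(Fin 15 → ℝ) → Matrix (Fin 4) (Fin 4) ℂ), (∀ y, ρ y = !![((y 0 : ℝ) : ℂ), (⟨y 2, y 3⟩ : ℂ), (⟨y 7, y
8⟩ : ℂ), (⟨y 9, y 10⟩ : ℂ); (⟨y 2, -y 3⟩ : ℂ), ((y 1 : ℝ) : ℂ), (⟨y 11, y 12⟩ : ℂ), (⟨y 13, y 14⟩ :
ℂ); (⟨y 7, -y 8⟩ : ℂ), (⟨y 11, -y 12⟩ : ℂ), ((y 4 : ℝ) : ℂ), (⟨y 5, y 6⟩ : ℂ); (⟨y 9, -y 10⟩ : ℂ),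
(⟨y 13, -y 14⟩ : ℂ), (⟨y 5, -y 6⟩ : ℂ), ((1 - y 0 - y 1 - y 4 : ℝ) : ℂ)]) → (∀ y, ρ' y = !![((y 0 :
ℝ) : ℂ), (⟨y 2, y 3⟩ : ℂ), (⟨y 7, -y 8⟩ : ℂ), (⟨y 11, -y 12⟩ : ℂ); (⟨y 2, -y 3⟩ : ℂ), ((y 1 : ℝ) :
ℂ), (⟨y 9, -y 10⟩ : ℂ), (⟨y 13, -y 14⟩ : ℂ); (⟨y 7, y 8⟩ : ℂ), (⟨y 9, y 10⟩ : ℂ), ((y 4 : ℝ) : ℂ),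
(⟨y 5, y 6⟩ : ℂ); (⟨y 11, y 12⟩ : ℂ), (⟨y 13, y 14⟩ : ℂ), (⟨y 5, -y 6⟩ : ℂ), ((1 - y 0 - y 1 - y 4 :
ℝ) : ℂ)]) → ∀ (r r' : Literature.NumberTheory.Transcendental.KZ.IntegralRep 15), r.domain = {y | (ρ
y).PosSemidef ∧ (ρ' y).PosSemidef} → Set.EqOn r.integrand (fun _ => 33) r.domain → r'.domain = {y |
(ρ y).PosSemidef} → Set.EqOn r'.integrand (fun _ => 8) r'.domain →
Literature.NumberTheory.Transcendental.KZ.Equivalent r r')`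

## Assembly
Pure logic (modus ponens), checked in Sketch.lean: Transport is literally QubitCore833 →
RebitCore2964 → Target, so
QubitCore833 → RebitCore2964 → Transport → Target. Positive composition is to the sector Target
(like PennerVolumes/PhiFourLaboratory);
the logical position relative to the summit is the support item SectorOfSummit
(KontsevichZagierPeriods ∧ the two value theorems ⇒
Target): every conjunct and both fibre cruxes are NECESSARY for the H21-literal Conjecture 1, so a
genuine non-derivability proof of
any of them closes this route `refuted:` and refutes the summit (hand the witness to route Neg).
DefectPoly, DefectLogRebit, XStates25,
FibreReflection are not in the implication chain: they are the engine parts of the foreseen chains.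

Rationale: WHY THIS LINE. The separability-probability identities are the only rational volume ratios between
explicit spectrahedra in dimension ≥ 9 whose values
are THEOREMS (LovasAndai2017 Thm 2; HuongKhoi2024, ZhangJiangXie2025 Prop 6.10) after fifteen years
of being "strikingly difficult"
(LovasAndai2017; BengtssonZyczkowski2017 §16.6 still lists 8/33 as unproved), and Conjecture 1 says
each must be a finite dissection-
and-shear between two ℚ-semialgebraic bodies — a statement of solid geometry about entanglement that
nobody has written down. Imported:
quantum information (reduction criterion HorodeckiHorodecki1999 ⇒ PPT-on-the-fibre = central
reflection; Milz–Strunz invariance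
MilzStrunz2014/LovasAndai2017 Thm 1 ⇒ one congruence CoV (1⊗L)ρ(1⊗L)* transports the central fibre
to every fibre, and
`Literature.NumberTheory.Transcendental.KZ.Equivalent.prod` (PROVED, KZProductIdeal) multiplies the
fibre chain by the base), random-
matrix/symplectic volume technology (Życzkowski–Sommers, Duistermaat–Heckman for the partial-trace
moment map, ChristandlEtAl2012,
ZhangJiangXie2025) and Lovas–Andai's defect functions of the operator-norm ball (LovasAndai2017
Lemma 6, Slater2018). What the line adds
to the negatives index (empty) and to prior routes (none touches spectrahedra, PSD cones or quantum
states; KinematicFormulas/SelbergAMGM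
treat invariant measures, MatrixModel cards treat the unitarily INVARIANT side = vol D only): a
sharply isolated test where BOTH printed
proofs of a proved rational period identity fail to be chains for NAMED reasons — the Lovas–Andai
fibration needs the pointwise defect
identity χ̃₂(ε) = ε²(4−ε²)/3 (Slater2018, unproved), and the spectral Duistermaat–Heckman proof
reaches the 12-dim core only as a
measure-zero slice of 15-dim bodies (limit a → 0, ZhangJiangXie2025 §6.2) — while the rebit proof
(LovasAndai2017 pp. 7–11, App. A)
is limit-free and move-by-move inside the rules up to a weight-2 dilogarithm cancellation.

RANKED CRUXES. #0 Target (target) — Rebit2964 ∧ Qubit833: the two global Conjecture-1 instances —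
[P_ℝ, 64] ~ [D_ℝ, 29] in dimension 9 (coordinates y: X = [[y0,y2],[y2,y1]], Y =
[[y3,y4],[y4,1−y0−y1−y3]], Z = [[y5,y6],[y7,y8]], ρ = [[X,Z],[Zᵀ,Y]], ρ^Γ = [[X,Zᵀ],[Z,Y]]) and
[P_ℂ, 33] ~ [D_ℂ, 8] in dimension 15 (X = [[y0, y2+y3i],[·,y1]], Y = [[y4, y5+y6i],[·, 1−y0−y1−y4]],
Z = [[y7+y8i, y9+y10i],[y11+y12i, y13+y14i]], ρ = [[X,Z],[Z*,Y]], ρ^Γ = [[X,Z*],[Z,Y]] = partial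
transpose on the first factor); domains = PSD sets of the displayed Hermitian matrix functions,
integrands the displayed constants. Values: 64·vol P_ℝ = 29·vol D_ℝ (LovasAndai2017 Thm 2), 33·vol
P_ℂ = 8·vol D_ℂ (HuongKhoi2024; ZhangJiangXie2025); hit-and-run Monte-Carlo of exactly these typed
sets (kit j000513, planner folder num/hitrun.py): global 0.2409±0.0023 (8/33 = 0.2424) and
0.4526±0.0020 (29/64 = 0.4531); fibres 0.2433±0.0018 and 0.4530±0.0021. (why it might fail: Never by
value (both ratios are theorems). False iff the fixed H21 calculus cannot connect two equal-valued
KZ-rational representations — then the summit is false (SectorOfSummit). As typed: a slip in the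
block/conjugation layout (guarded by kit j000373 asserts + j000513).) [LovasAndai2017,
HuongKhoi2024, ZhangJiangXie2025, Peres1996, HorodeckiHorodeckiHorodecki1996, KontsevichZagier2001]
#2 QubitCore833 (crux) — THE CENTRAL-SYMMETRY CORE, complex (card E4/E6 recast). K = {x ∈ ℝ¹² : ρ(x)
≽ 0}, ρ(x) = [[X, Z],[Z*, ½−X]] with X = [[x0, x2+x3i],[·, x1]], Z = [[x4+x5i, x6+x7i],[x8+x9i,
x10+x11i]] — the two-qubit states whose second marginal Tr₁ρ = X + (½−X) is maximally mixed; Core =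
K ∩ {½·1 − ρ(x) ≽ 0} = K ∩ σK, σ = point reflection through ¼·1 (= the PPT = separable states of the
fibre: ρ^Γ = W(½·1−ρ)W*, FibreReflection). Claim: [Core, 33] ~ [K, 8] (IntegralRep 12, constant
integrands). Value: vol₁₂(Core)/vol₁₂(K) = 8/33 (HuongKhoi2024 Prop = ZhangJiangXie2025 Prop
6.9–6.10 with vol_HS(K) = π⁵/9676800, f(0) = 8π⁵/319334400; equivalently LovasAndai2017 Cor 2
fibre-independence + the global 8/33); hit-and-run MC of the typed sets 0.2433 ± 0.0018, global
15-dim ratio 0.2409 ± 0.0023 (kit j000513). Two candidate chains: (A) Lovas–Andai fibration at D =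
½: Schur CoV Z = X^{1/2}C(½−X)^{1/2} (semialgebraic, Jacobian det(X)²det(½−X)²), unitary
diagonalisation of X (finite/semialgebraic SVD cells), fibre = B ∩ V_εBV_ε⁻¹ with ε² = ratio of the
eigenvalues of X(½−X)⁻¹ — then DefectPoly (rank 4) + a residual 2-dim rational-integrand identity
with rational value (Slater2018 p. 10: numerator 2048/51975 against denominator 256/1575, and indeed
33·2048/51975 = 8·256/1575 since 51975 = 33·1575); (B) spectral: Core = {0 ≼ ρ ≼ ½, Tr₁ρ = ½} is the
zero fibre of the SU(2) moment map on the U(4)-invariant body E = {0 ≼ ρ ≼ ½·1, Tr ρ = 1}; Weyl CoV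
+ Duistermaat–Heckman give vol₁₅(E ∩ {|bloch(Tr₁ρ)| ≤ t}) as an explicit polynomial × π⁶ for t < 1/3
(ZhangJiangXie2025 Prop 6.10), and vol₁₂(Core) is its normalised third derivative at t = 0 — a
limit, not a move. [deps: DefectPoly, FibreReflection] [difficulty: XL] (why it might fail: Not by
value (8/33 is a theorem). As a CHAIN: plan (A) needs the pointwise defect identity DefectPoly,
which is unproved and may be false; plan (B) reaches this 12-dim body only as a null slice of 15-dim
bodies (limit t→0 = ZJX §6.2) — if DefectPoly dies no limit-free proof is known at all.)
[HuongKhoi2024, ZhangJiangXie2025, LovasAndai2017, Slater2018, HorodeckiHorodecki1999,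
ChristandlEtAl2012]
#3 RebitCore2964 (crux) — THE CENTRAL-SYMMETRY CORE, real (card E3 on the fibre). K_ℝ = {x ∈ ℝ⁷ :
ρ(x) ≽ 0}, ρ(x) = [[X, Z],[Zᵀ, ½−X]], X = [[x0,x2],[x2,x1]], Z = [[x3,x4],[x5,x6]] (two-rebit states
with maximally mixed second marginal); Core_ℝ = K_ℝ ∩ {½·1 − ρ ≽ 0}. Claim: [Core_ℝ, 64] ~ [K_ℝ, 29]
(IntegralRep 7). Value: LovasAndai2017 Thm 2 (29/64) with Cor 2 (the conditional PPT probability is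
independent of the marginal D; Thm 2 is computed FROM the fibre formula eq. (psep)); hit-and-run MC
of the typed sets 0.4530 ± 0.0021, and 0.4528 ± 0.0021 on the fibre over D = diag(.7,.3), global
9-dim ratio 0.4526 ± 0.0020 (kit j000513). Foreseen chain = LA's proof made semialgebraic (≈ 30
moves): Schur CoV Z = X^{1/2}C(½−X)^{1/2} (Jacobian det X·det(½−X)); rotation cells diagonalising X
(tan-half-angle chart, Jacobian |ξ₁−ξ₂|, the angular factor [ℝ, 2/(1+t²)] carried as a spectator on
BOTH sides, never integrated out); fibre = B_ℝ ∩ V_εB_ℝV_ε⁻¹ handled by DefectLogRebit (LA Lemma 6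
as a uniform chain, App. A: in the chart (r, w = e^t, ρ, tan φ/2) the conjugation is the scaling w ↦
εw and the volume form is r³); LA p. 8: u = (1−x)/(1+x), (u,v) ↦ (ts, s/t) (rule 2), one integration
by parts (rules 1+3, rational primitive), Fubini is free; final step: LA's closing identity
(64/3)∫₀¹ R(t)·χ̃₁′(t) dt = 1/4 (p. 8) with R(t) = (11(1−t⁶)+27t²(1−t²)+6(1+t²)(1+8t²+t⁴)log
t)/(t²−1)⁷ and χ̃₁′(t) = (4/π²)(t+1/t−½(t−1/t)²log((1+t)/(1−t)))/t, i.e. a 3-dim rational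
representation (both logs unfolded: log t = −∫_t^1 du/u, log((1+t)/(1−t)) = ∫₀^t 2du/(1−u²))
KZ-equivalent to (3/256)·[π]⋆[π] — LA exhibit the primitive (Li₂(1−t), Li₂(−t), log t·log(1+t),
atanh; p. 8), so only Li₂(1) = π²/6-type evaluations remain, which have classical algebraic-CoV
chains (Calabi: (p,q) = (tan u, tan v), ∫∫_{pq<1} dp dq/((1+p²)(1+q²)) = π²/8 by the involution
(p,q) ↦ (1/p,1/q)). [deps: DefectLogRebit, FibreReflection] [difficulty: L] (why it might fail:
Value proved. Chain risk: LA's closing primitive (Li₂(1−t), Li₂(−t), log·log, p. 8) is not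
semialgebraic (barrier noSemialgebraicPrimitive_inv_sub_two), so both logs must ride as extra
variables and the weight-2 cancellation to (3/256)π² be redone by moves; plus SVD/rotation cells off
null sets.) [LovasAndai2017, Slater2018, KontsevichZagier2001]
#4 DefectPoly (crux) — SLATER'S DEFECT IDENTITY as a uniform family of 8-dim instances (card E4). B
= operator-norm unit ball of ℂ^{2×2} in real coordinates z ∈ ℝ⁸ (M = [[z0+z1i, z2+z3i],[z4+z5i,
z6+z7i]]; ‖M‖ ≤ 1 ⟺ Tr M*M ≤ 2 ∧ det(1 − M*M) = 1 − Σz² + |det M|² ≥ 0 — polynomial), and for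
rational ε ∈ (0,1] the conjugate condition ‖V_ε⁻¹MV_ε‖ ≤ 1, V_ε = diag(1, ε) (entries b ↦ εb, c ↦
c/ε; written ×ε² as polynomials). Claim: [B ∩ V_εBV_ε⁻¹, 3] ~ [B, ε²(4−ε²)] for every rational 0 < ε
≤ 1, i.e. Lovas–Andai's χ̃₂(ε) = ε²(4−ε²)/3 with a rules-proof uniform in ε (parameter-as-variable:
d/dε of the moving wall as Newton–Leibniz in ε with a semialgebraic primitive — polynomiality of a
period function is the one case where a rules-proof is easier than an analytic one). Under it, plan
(A) of QubitCore833 has no transcendental step at all. Value status: CONJECTURAL (Slater2018 eq.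
(VerifiedFormula), from cylindrical algebraic decomposition on the 11-dim subfamily with diagonal
D₁, D₂, validated only through the sum rule ∫χ̃₂ dμ = 8/33 — now a theorem — and sampling); planner
MC (kit j000373, 8-dim rejection, 3.2M samples each): χ̃₂(0.5) = 0.3160±0.0015 (formula 0.3125),
χ̃₂(0.7) = 0.5721±0.0016 (0.5733), χ̃₂(0.3) = 0.1161±0.0010 (0.1173) — consistent at the 1% level,
undecided. [difficulty: L] (why it might fail: The VALUE identity is conjectural: Slater derived χ̃₂
by CAD on an 11-dim nullified-entry subfamily plus the 8/33 sum rule; his own reduced-family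
estimate χ̃₂(1/2) ≈ 0.368 ≠ 5/16, planner MC sits at z = +2.4 at ε = 1/2. False at one rational ε ⇒
¬DefectPoly by soundness.) [Slater2018, LovasAndai2017]
#5 Transport (crux) — MILZ–STRUNZ INVARIANCE AS A CHAIN (card E5): the two fibre instances imply the
two global ones, QubitCore833 → RebitCore2964 → Target. Mechanism: the local filtering
(1⊗L)ρ₀(1⊗L)*, L = Cholesky factor of 2ρ_B over the open Bloch ball (semialgebraic section), maps
base × K bijectively onto the faithful-marginal part of D (complement null), is linear in ρ₀ with
fibre Jacobian |det L|^{12} = det(2ρ_B)⁶ (complex; |det L|⁷ = det(2ρ_B)^{7/2} real — LovasAndai2017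
Thm 1 exponents 4d − d²/2), preserves ≽ 0 and commutes with Γ on the first factor, so ONE change of
variables (rule 2) turns [P, 33] into [base × Core, 33·J(m)] = [base, J]⋆[Core, 33] and [D, 8] into
[base, J]⋆[K, 8]; `KZ.Equivalent.prod` (proved, Literature KZProductIdeal) multiplies the fibre
chain by [base, J]. No averaging, no singular-value reduction, no χ-function is needed for this
step. [deps: QubitCore833, RebitCore2964] [difficulty: M] (why it might fail: Only bookkeeping, but
real: a ℚ-semialgebraic Cholesky section over the open Bloch ball, InjOn/HasFDerivWithinAt of (m,x)
↦ (1⊗L(m))ρ₀(x)(1⊗L(m))* on a full-measure cell, its 15×15 Jacobian = det(2m)⁶·(base factor) in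
Lean, null set of singular marginals.) [MilzStrunz2014, LovasAndai2017, KontsevichZagier2001]
#9 FibreReflection (support) — PPT = CENTRAL REFLECTION ON THE FIBRE (Huong–Khoi's spectral
criterion = the reduction criterion of HorodeckiHorodecki1999 for qubits): for the real 7-dim and
complex 12-dim fibre parametrisations, ρ(x)^Γ ≽ 0 ↔ ½·1 − ρ(x) ≽ 0, because ρ^Γ = (DS)(½·1 − ρ)(DS)ᵀ
with S the block swap and D = diag(1,1,−1,−1) (uses only X + Y = ½·1). Three-line matrix identity +
`Matrix.PosSemidef` congruence lemmas; links the cores of QubitCore833/RebitCore2964 to the literal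
PPT bodies of Target (needed inside Transport). [difficulty: provable-now] [HorodeckiHorodecki1999,
HuongKhoi2024, ZhangJiangXie2025]
#9 SectorOfSummit (support) — LOGICAL POSITION: KontsevichZagierPeriods → (64·vol P_ℝ = 29·vol D_ℝ,
stated as value equality of the two typed 9-dim representations) → (33·vol P_ℂ = 8·vol D_ℂ, likewise
in dimension 15) → Target. Constant integrands are IsRational (p = C a, q = 1), so each conjunct of
Target is an instance of the summit; refuting a conjunct by a genuine non-derivability proof refutes
the summit. The two value hypotheses are LovasAndai2017 Thm 2 and HuongKhoi2024 (cite-facts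
requested). [difficulty: provable-now] [KontsevichZagier2001, LovasAndai2017, HuongKhoi2024]
#9 DefectLogRebit (support) — LOVAS–ANDAI LEMMA 6 AS A UNIFORM CHAIN (first brick of RebitCore2964):
for rational 0 < ε ≤ 1, [B_ℝ ∩ V_εB_ℝV_ε⁻¹, 3] (IntegralRep 4; B_ℝ = {z : Σz² ≤ 2, 1 − Σz² + (z0z3 −
z1z2)² ≥ 0} the operator-norm ball of ℝ^{2×2}) ~ the 2-dim rational representation [{0 < t < s < ε},
8((s²+1)/s³ − (s²−1)²/(s³(1−t²)))] (log((1+s)/(1−s)) unfolded as ∫₀^s 2dt/(1−t²)); value 3χ₁(ε) =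
8∫₀^ε (s + 1/s − ½(s−1/s)² log((1+s)/(1−s))) ds/s (χ₁(1) = 2π²/3; LovasAndai2017 Lemma 6 + Table 2,
PROVED there, App. A; planner MC χ̃₁(0.5) = 0.5312 ± 0.0004 = Simpson of Lemma 6, kit j000373).
Chain: LA's App. A atlas X = rY±(t,ρ,φ) with w = e^t, u = tan(φ/2) is semialgebraic, the similarity
by Λ_δ is the scaling w ↦ e^{−δ}w, √det g = r³ (NL in r, primitive r⁴/4), the comparison ‖Y(t−δ)‖ >
‖Y(t)‖ ⟺ t < δ/2 is a semialgebraic cell split, and the (ρ,φ)-integrals of p. 15 have rational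
primitives up to the one log kept as a variable. [difficulty: M] [LovasAndai2017, Slater2018]
#9 XStates25 (support) — X-STATES CALIBRATION (toy rung, provable now): two-qubit X-states ρ =
[[a,0,0,w],[0,b,z,0],[0,z̄,c,0],[w̄,0,0,d]], a+b+c+d = 1, form the 7-dim body D_X = {a,b,c,d ≥ 0,
|w|² ≤ ad, |z|² ≤ bc}; PPT_X = D_X ∩ {|w|² ≤ bc, |z|² ≤ ad}. Claim [PPT_X, 5] ~ [D_X, 2]
(Dunkl–Slater 2015: HS separability probability of X-states = 2/5, reproduced in Slater2018 §;
planner check E[min(ad,bc)²]/E[abcd] = 0.40003, kit j000504). Chain: disc fibres w = √(ad)·u (rule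
2, Jacobian ad) make both sides [Δ-cells, polynomial]⋆[disc]⋆[disc]; split Δ along ad = bc (c =
a(1−a−b)/(a+b), rational); iterated Newton–Leibniz with polynomial/rational primitives down to
dimension 0 on each side (values 2/5040 both) and back. Exercises exactly the
disc-fibre/product/min-cell bookkeeping of the big bodies. [difficulty: provable-now] [Slater2018,
MilzStrunz2014]

TWO-LAYER PLAN. Foreseen glued splits (k ≤ 3, depth 1), filed only after a crux closes or stalls
with a census:
QubitCore833 ⇐ FibreOverX (LA Thm 1 at D = ½ as a chain: Schur CoV + SVD cells, [Core,33] ~ [X-body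
× B-fibres, 33·det(X)²det(½−X)²·1_{conj}])
→ DefectPoly → SumRule833 (the residual 2-dim rational-integrand identity with rational value,
Slater2018 p. 10 numbers 2048/51975 and
256/1575) ; RebitCore2964 ⇐ DefectLogRebit → RebitIBP (LA p. 8 substitutions + IBP as moves, output
a 3-dim rational rep) →
DilogCancellation (that rep ~ (3/256)·[π]⋆[π]: weight-2 Euler-sum chain); Transport ⇐
CholeskySection (semialgebraic section + null set)
→ CongruenceJacobian (rule-2 instance with |det| = det(2m)⁶ resp. det(2m)^{7/2}) → Transport via
`KZ.Equivalent.prod`.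

KILL CRITERIA. Every item except DefectPoly has a CERTIFIED value side (LovasAndai2017 Thm 2 / Lemma
6; HuongKhoi2024 + ZhangJiangXie2025; Dunkl–Slater
2/5; FibreReflection is linear algebra): a genuine non-derivability proof of Target, QubitCore833,
RebitCore2964, DefectLogRebit or
XStates25 refutes the SUMMIT — report to the operator, close `refuted:<Decl>`, hand the witness to
route Neg. A refutation merely "as
typed" (values differ because a block/conjugation/coordinate convention slipped — guarded by the kit
jobs j000373/j000504/j000513) forces a
1:1 `--restate`, never a pivot. DefectPoly refuted (χ̃₂ ≠ ε²(4−ε²)/3 at some rational ε, e.g. by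
certified 6-dim integration after
quotienting U(1)²) is NOT a route kill: drop it (it is not in the Assembly), record Slater's formula
in the negatives index, and re-plan
QubitCore833 along the spectral line (B) together with the structural routes on specialisation of
uniform chains (StandardParts,
ValuedFieldSpecialisation, card limit-is-a-move) — that outcome is itself the route's most
informative possible finding ("8/33 has no
limit-free proof in print"). The route is MOOTED if KZKernelConjecture is proved (everything
follows) and SHORTENED if a general
"Duistermaat–Heckman push-forward under an algebraic moment map is a chain" theorem (card
bending-flows-dh-is-a-move) or MultivaluedCoV's
sheet-transfer lands first.

NOT DECOMPOSED YET. The spectral line (B) as typed items — the 15-dim shell identities vol(E ∩ {|b|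
≤ t}) = explicit ℚ[t]·π⁶ for rational t < 1/3
(ZhangJiangXie2025 Prop 6.10; non-abelian DH for the partial trace as moves) are filed INFORMALLY
right after open (rank 6,
SpectralShellDH) until the HS/Lebesgue/symplectic normalisation constants are certified by a kit
job; the quaternionic 26/323 (27-dim,
value conjectural, Slater2018); the operator-monotone √x measure companion (LovasAndai2017 Thm 4:
only the numerical value 0.26223 with
complete elliptic K, E in the integrand — no closed form, mixed weight; not filed); qubit–qutrit;
the general finite-averaging lemma and
the general DH-is-a-chain statement (belong to cards integral-geometry-kinematic-formulas-compile
and bending-flows-dh-is-a-move); the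
sub-lemmas of Transport (Cholesky semialgebraicity, Jacobian) — layer-2 children later; Literature
facts LovasAndai 29/64 and Huong–Khoi
8/33 as named `def`s (cite work-items filed after open; no statement of this route imports them —
values enter only SectorOfSummit as
explicit hypotheses).

CHEAPEST FALSIFIER. Run first, cheapest first: (i) the typed sets themselves — hit-and-run uniform
sampling with exact PSD chords (planner folder
num/hitrun.py, kit j000513): complex fibre core fraction 0.2433 ± 0.0018 (8/33 = 0.2424), real fibre
0.4530 ± 0.0021 (29/64 = 0.4531), global 15-dim 0.2409 ± 0.0023, global 9-dim 0.4526 ± 0.0020, real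
fibre over D = diag(.7,.3) 0.4528 ± 0.0021 (invariance);
box-rejection MC is BIASED here (off-diagonal entries reach 1/2; a ±1/4 box gave 0.48 for the real
fibre — kit j000373/j000504, do not
repeat that mistake); (ii) DefectPoly at ε = 1/2: χ̃₂(1/2) = vol₈(B ∩ V B V⁻¹)/vol₈(B) against 5/16
= 0.3125 — planner MC 0.3160 ± 0.0015
(z = +2.4, kit j000373, num/sep_mc.py); a 10× larger or quasi-MC run, or Slater's own CAD pushed to
the full 15-dim body, decides it;
(iii) the lookup that would kill the NOVELTY: a dissection/bijective or "integration-free" proof of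
8/33 or 29/64 already in print —
searched (see Novelty): none; HuongKhoi2024 itself is paywalled (lit want filed; ZhangJiangXie2025
READ reports its method: spectral
criterion + DH + limit).

NUMBERS. vol(D_ℂ) = π⁶/(√2·2¹⁴·3⁴·5³·7²·11·13), vol(D_ℝ) = π⁴/(√2·2⁶·3³·35) in LA's chart
(LovasAndai2017 §5 = ZyczkowskiSommers2003);
vol_HS(K) = π⁵/9676800 and Lebesgue vol₁₂(K) = π⁵/(9676800·128) in the typed chart (MC 2.466e−7 vs
2.4706e−7, kit j000373);
f(a) = π⁵/319334400·(1−a)⁹(33a³+162a²+72a+8) on (0,1/3), f(0)/vol_HS(K) = 8/33 (ZhangJiangXie2025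
Prop 6.7, 6.10); 29/64 =
(16/35 − 1/4)/(16/35) (LovasAndai2017 p. 8); χ₁(1) = vol₄(B_ℝ) = 2π²/3 (MC 6.576), vol₈(B_ℂ) = π⁴/12
in dRe·dIm coordinates (MC 8.10;
LA's λ₈ gives π⁴/6); χ̃₁(0.5) = 0.5312; Slater: χ̃₂(ε) = ε²(4−ε²)/3 (conj.), numerator 2048/51975,
denominator 256/1575; X-states 2/5
(rebit X-states 16/(3π²), quaterbit 2/7: Dunkl–Slater via Slater2018); items at open: 10 typed (1
target, 1 assembly, 4 cruxes, 4
support) + 1 informal crux (rank 6) and 2 cite-facts filed right after open.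

DEFINITION REQUESTS. None blocking (all bodies are typed inline over `Matrix.PosSemidef`; complex
PSD needs the term-level `open scoped ComplexOrder in`,
as in the statements). Cite facts wanted (filed after open with `ledger workitem add --kind cite`):
LovasAndai2017 Thm 2 (64·vol P_ℝ =
29·vol D_ℝ for the typed 9-dim bodies) and HuongKhoi2024 main theorem (33·vol P_ℂ = 8·vol D_ℂ for
the typed 15-dim bodies) as
`Literature.Probability.RandomMatrices…`-style named facts — hypotheses of SectorOfSummit only.
Optional later: a reusable
`TwoQubitState`/partial-transpose vocabulary under
Summits/KontsevichZagierPeriods/KontsevichZagierPeriods/Theorems if provers want to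
shorten the literals.

Novelty: Searches (2026-08-15): `lit search "two-qubit Hilbert-Schmidt separability probability 8/33 proof
Lovas Andai"` (45 rows: found
HuongKhoi2024 = doi:10.1088/1751-8121/ad8493 — the 2024 PROOF of 8/33, unknown to the card — and 30+
Slater papers; none mentions
periods, Kontsevich–Zagier, dissections or motives); `lit search --source arxiv "Huong Khoi
separability probability two-qubit"` (1:
ZhangJiangXie2025 = arXiv:2507.02369, READ: DH re-derivation); `lit read arxiv:1610.01410`
(LovasAndai2017 READ in full: Thm 1, Cor 1–2,
Thm 2, Lemma 6, App. A–B); `lit read arxiv:1701.01973 --grep` (Slater2018 READ pp. 3, 9–11: CAD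
derivation of χ̃₂ on the 11-dim
subfamily, X-states 16/(3π²), 2/5, 2/7); `lit search --hybrid "reduction criterion separability two
qubits partial transpose"`
(10 held books; BengtssonZyczkowski2017 READ pp. 454, 457–458, 464: reduction map Φ_R(σ) = Tr σ·1 −
σ, "cannot be stronger than PPT",
and "p₂ = 8/33 … has not been rigorously proven so far"); `lit galaxy search "separability
probability" --star all` (2: a biography
dictionary and Slater arXiv:1605.06459); `lit galaxy search "Duistermaat-Heckman measure separable"
--star all` (0); `lit frontier
KontsevichZagierPeriods --since 2020` (30 rows, none on quantum-state volumes); `lit bridges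
KontsevichZagierPeriods --cross any` (30
rows, none); `ledger idea list` (123 cards of the sub-problem: only this card mentions
qubits/spectrahedra; related engines
hciz-compiles-gelfand-tsetlin-plus-lw, matrix-model-couplings-  [refs: 10.1088/1751-8121/ad8493, 10.1088/1751-8121/aa7176, 10.1007/s11128-018-1854-5, 2507.02369, 1610.01410, 1701.01973, 1605.06459, doi:10.1088/1751-8121/ad8493, arxiv:1610.01410, arxiv:1701.01973, doi:10.1088/1751-8121/aa7176, doi:10.1007/s11128-018-1854-5, HuongKhoi2024, ZhangJiangXie2025, LovasAndai2017, Slater2018, BengtssonZyczkowski2017, HorodeckiHorodecki1999]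

Barriers (technique_class: instance-compilation, spectrahedra, parametric-NL, DH): - technique_class: instance-compilation, spectrahedra, parametric-NL, DH
- Literature.Barriers.KontsevichZagierPeriods.noSemialgebraicPrimitive_inv_sub_two: ENGAGED on the
rebit line (RebitCore2964, DefectLogRebit): LA's primitives contain log((1+s)/(1−s)), Li₂(1−t),
Li₂(−t), log t·log(1+t) — none semialgebraic, so rule 3 cannot use them; evaded the standard way
(add variables: every log/dilog is carried as an extra integration variable with a RATIONAL
integrand, and only rational/polynomial primitives are ever used — exactly the barrier's own listed
evasion "add variables"); NOT engaged on the qubit line if DefectPoly holds (polynomial defect ⇒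
polynomial primitives only), and the angular 2/(1+t²) factors of rotation cells are carried as
spectators on both sides, never integrated out.
- Literature.Barriers.KontsevichZagierPeriods.cressonViuSos_prop_3_2: respected, not engaged — every
foreseen chain dissects first (Schur/SVD cells, the ad = bc split, sign cells, null sets of singular
marginals) and no global scissors-free semialgebraic map P → D is claimed (none can exist
equivariantly: P and D have different symmetry); the bodies are spectrahedra, not polyhedra, and of
dimension ≤ 15 where the Hauptvermutung hypothesis is anyway not met by convex bodies.
- Literature.Barriers.KontsevichZagierPeriods.kzConjecture_implies_oddZetaAlgIndep: not engaged —
single instances with proved (29/64, 8/33, 2/5, Lemma 6) or explicitly conjectural (DefectPoly)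
value hypotheses assert no alg

History (route lifecycle, newest last):
- 2026-08-15T13:48:37Z · CLOSED retired — not-a-thesis: assembly does not conclude the sub-problem Statement (operator:999:1257524)

sub-problem: KontsevichZagierPeriods · status: closed(retired) · opened planner-plancard-KontsevichZagierPeriods-Kont-a2532eab-0 2026-08-15T12:53:06Z · rev 0 · ledger route-KontsevichZagierPeriods-SeparabilityScissors
GENERATED by the gate from the ledger (D-0016/17). Provers cite these decls: `theorem foo : Summit.KontsevichZagierPeriods.KontsevichZagierPeriods.Theses.SeparabilityScissors.<Decl> := …` in Summits/KontsevichZagierPeriods/KontsevichZagierPeriods/Theorems/<Name>.lean.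
-/

namespace Summit.KontsevichZagierPeriods.KontsevichZagierPeriods.Theses.SeparabilityScissors

open scoped BigOperators Topology Manifold Classical MeasureTheory ProbabilityTheory Matrix InnerProductSpace ComplexConjugate ContinuousMap
open Filter Set Function TopologicalSpace MeasureTheory

attribute [summit_statement] _root_.KontsevichZagierPeriods

open Literature Periods

/-- item stmt-KontsevichZagierPeriods-8487 · target · rank 0 · closed · moot by None · by planner
why it might fail: Never by value (both ratios are theorems). False iff the fixed H21 calculus cannot connect two equal-valued KZ-rational representations — then the summit is false (SectorOfSummit). As typed: a slip in the block/conjugation layout (guarded by kit j000373 asserts + j000513).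
sources: LovasAndai2017, HuongKhoi2024, ZhangJiangXie2025, Peres1996, HorodeckiHorodeckiHorodecki1996, KontsevichZagier2001
[target] Rebit2964 ∧ Qubit833: the two global Conjecture-1 instances — [P_ℝ, 64] ~ [D_ℝ, 29] in
dimension 9 (coordinates y: X = [[y0,y2],[y2,y1]], Y = [[y3,y4],[y4,1−y0−y1−y3]], Z =
[[y5,y6],[y7,y8]], ρ = [[X,Z],[Zᵀ,Y]], ρ^Γ = [[X,Zᵀ],[Z,Y]]) and [P_ℂ, 33] ~ [D_ℂ, 8] in dimension
15 (X = [[y0, y2+y3i],[·,y1]], Y = [[y4, y5+y6i],[·, 1−y0−y1−y4]], Z = [[y7+y8i, y9+y10i],[y11+y12i,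
y13+y14i]], ρ = [[X,Z],[Z*,Y]], ρ^Γ = [[X,Z*],[Z,Y]] = partial transpose on the first factor);
domains = PSD sets of the displayed Hermitian matrix functions, integrands the displayed constants.
Values: 64·vol P_ℝ = 29·vol D_ℝ (LovasAndai2017 Thm 2), 33·vol P_ℂ = 8·vol D_ℂ (HuongKhoi2024;
ZhangJiangXie2025); hit-and-run Monte-Carlo of exactly these typed sets (kit j000513, planner folder
num/hitrun.py): global 0.2409±0.0023 (8/33 = 0.2424) and 0.4526±0.0020 (29/64 = 0.4531); fibres
0.2433±0.0018 and 0.4530±0.0021. -/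
@[route_item "route-KontsevichZagierPeriods-SeparabilityScissors"]
def Target : Prop :=
  (∀ (ρ ρ' : (Fin 9 → ℝ) → Matrix (Fin 4) (Fin 4) ℝ), (∀ y, ρ y = !![y 0, y 2, y 5, y 6; y 2, y 1, y 7, y 8; y 5, y 7, y 3, y 4; y 6, y 8, y 4, 1 - y 0 - y 1 - y 3]) → (∀ y, ρ' y = !![y 0, y 2, y 5, y 7; y 2, y 1, y 6, y 8; y 5, y 6, y 3, y 4; y 7, y 8, y 4, 1 - y 0 - y 1 - y 3]) → ∀ (r r' : Literature.NumberTheory.Transcendental.KZ.IntegralRep 9), r.domain = {y | (ρ y).PosSemidef ∧ (ρ' y).PosSemidef} → Set.EqOn r.integrand (fun _ => 64) r.domain → r'.domain = {y | (ρ y).PosSemidef} → Set.EqOn r'.integrand (fun _ => 29) r'.domain → Literature.NumberTheory.Transcendental.KZ.Equivalent r r') ∧ (open scoped ComplexOrder in ∀ (ρ ρ' : (Fin 15 → ℝ) → Matrix (Fin 4) (Fin 4) ℂ), (∀ y, ρ y = !![((y 0 : ℝ) : ℂ), (⟨y 2, y 3⟩ : ℂ), (⟨y 7, y 8⟩ :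 ℂ), (⟨y 9, y 10⟩ : ℂ); (⟨y 2, -y 3⟩ : ℂ), ((y 1 : ℝ) : ℂ), (⟨y 11, y 12⟩ : ℂ), (⟨y 13, y 14⟩ : ℂ); (⟨y 7, -y 8⟩ : ℂ), (⟨y 11, -y 12⟩ : ℂ), ((y 4 : ℝ) : ℂ), (⟨y 5, y 6⟩ : ℂ); (⟨y 9, -y 10⟩ : ℂ), (⟨y 13, -y 14⟩ : ℂ), (⟨y 5, -y 6⟩ : ℂ), ((1 - y 0 - y 1 - y 4 : ℝ) : ℂ)]) → (∀ y, ρ' y = !![((y 0 : ℝ) : ℂ), (⟨y 2, y 3⟩ : ℂ), (⟨y 7, -y 8⟩ : ℂ), (⟨y 11, -y 12⟩ : ℂ); (⟨y 2, -y 3⟩ : ℂ), ((y 1 : ℝ) : ℂ), (⟨y 9, -y 10⟩ : ℂ), (⟨y 13, -y 14⟩ : ℂ); (⟨y 7, y 8⟩ : ℂ), (⟨y 9, y 10⟩ : ℂ), ((y 4 : ℝ) : ℂ), (⟨y 5, y 6⟩ : ℂ); (⟨y 11, y 12⟩ : ℂ), (⟨y 13, y 14⟩ : ℂ), (⟨y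 5, -y 6⟩ : ℂ), ((1 - y 0 - y 1 - y 4 : ℝ) : ℂ)]) → ∀ (r r' : Literature.NumberTheory.Transcendental.KZ.IntegralRep 15), r.domain = {y | (ρ y).PosSemidef ∧ (ρ' y).PosSemidef} → Set.EqOn r.integrand (fun _ => 33) r.domain → r'.domain = {y | (ρ y).PosSemidef} → Set.EqOn r'.integrand (fun _ => 8) r'.domain → Literature.NumberTheory.Transcendental.KZ.Equivalent r r')

/-- item stmt-KontsevichZagierPeriods-8488 · crux · rank 2 · closed · moot by None · by planner
why it might fail: Not by value (8/33 is a theorem). As a CHAIN: plan (A) needs the pointwise defect identity DefectPoly, which is unproved and may be false; plan (B) reaches this 12-dim body only as a null slice of 15-dim bodies (limit t→0 = ZJX §6.2) — if DefectPoly dies no limit-free proof is known at all.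
sources: HuongKhoi2024, ZhangJiangXie2025, LovasAndai2017, Slater2018, HorodeckiHorodecki1999, ChristandlEtAl2012
[crux] THE CENTRAL-SYMMETRY CORE, complex (card E4/E6 recast). K = {x ∈ ℝ¹² : ρ(x) ≽ 0}, ρ(x) = [[X,
Z],[Z*, ½−X]] with X = [[x0, x2+x3i],[·, x1]], Z = [[x4+x5i, x6+x7i],[x8+x9i, x10+x11i]] — the
two-qubit states whose second marginal Tr₁ρ = X + (½−X) is maximally mixed; Core = K ∩ {½·1 − ρ(x) ≽
0} = K ∩ σK, σ = point reflection through ¼·1 (= the PPT = separable states of the fibre: ρ^Γ =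
W(½·1−ρ)W*, FibreReflection). Claim: [Core, 33] ~ [K, 8] (IntegralRep 12, constant integrands).
Value: vol₁₂(Core)/vol₁₂(K) = 8/33 (HuongKhoi2024 Prop = ZhangJiangXie2025 Prop 6.9–6.10 with
vol_HS(K) = π⁵/9676800, f(0) = 8π⁵/319334400; equivalently LovasAndai2017 Cor 2 fibre-independence +
the global 8/33); hit-and-run MC of the typed sets 0.2433 ± 0.0018, global 15-dim ratio 0.2409 ±
0.0023 (kit j000513). Two candidate chains: (A) Lovas–Andai fibration at D = ½: Schur CoV Z =
X^{1/2}C(½−X)^{1/2} (semialgebraic, Jacobian det(X)²det(½−X)²), unitary diagonalisation of X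
(finite/semialgebraic SVD cells), fibre = B ∩ V_εBV_ε⁻¹ with ε² = ratio of the eigenvalues of
X(½−X)⁻¹ — then DefectPoly (rank 4) + a residual 2-dim rational-integrand identity with rational
value (Slater2018 p. 10: numerator 2048/5 -/
@[route_item "route-KontsevichZagierPeriods-SeparabilityScissors"]
def QubitCore833 : Prop :=
  open scoped ComplexOrder in ∀ (ρ : (Fin 12 → ℝ) → Matrix (Fin 4) (Fin 4) ℂ), (∀ x, ρ x = !![((x 0 : ℝ) : ℂ), (⟨x 2, x 3⟩ : ℂ), (⟨x 4, x 5⟩ : ℂ), (⟨x 6, x 7⟩ : ℂ); (⟨x 2, -x 3⟩ : ℂ), ((x 1 : ℝ) : ℂ), (⟨x 8, x 9⟩ : ℂ), (⟨x 10, x 11⟩ : ℂ); (⟨x 4, -x 5⟩ : ℂ), (⟨x 8, -x 9⟩ : ℂ), ((1 / 2 - x 0 : ℝ) : ℂ), (⟨-x 2, -x 3⟩ : ℂ); (⟨x 6, -x 7⟩ : ℂ), (⟨x 10, -x 11⟩ : ℂ), (⟨-x 2, x 3⟩ : ℂ), ((1 / 2 - x 1 : ℝ) : ℂ)]) → ∀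 (r r' : Literature.NumberTheory.Transcendental.KZ.IntegralRep 12), r.domain = {x | (ρ x).PosSemidef ∧ ((2 : ℂ)⁻¹ • (1 : Matrix (Fin 4) (Fin 4) ℂ) - ρ x).PosSemidef} → Set.EqOn r.integrand (fun _ => 33) r.domain → r'.domain = {x | (ρ x).PosSemidef} → Set.EqOn r'.integrand (fun _ => 8) r'.domain → Literature.NumberTheory.Transcendental.KZ.Equivalent r r'

/-- item stmt-KontsevichZagierPeriods-8489 · crux · rank 3 · closed · moot by None · by planner
why it might fail: Value proved. Chain risk: LA's closing primitive (Li₂(1−t), Li₂(−t), log·log, p. 8) is not semialgebraic (barrier noSemialgebraicPrimitive_inv_sub_two), so both logs must ride as extra variables and the weight-2 cancellation to (3/256)π² be redone by moves; plus SVD/rotation cells off null sets.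
sources: LovasAndai2017, Slater2018, KontsevichZagier2001
[crux] THE CENTRAL-SYMMETRY CORE, real (card E3 on the fibre). K_ℝ = {x ∈ ℝ⁷ : ρ(x) ≽ 0}, ρ(x) =
[[X, Z],[Zᵀ, ½−X]], X = [[x0,x2],[x2,x1]], Z = [[x3,x4],[x5,x6]] (two-rebit states with maximally
mixed second marginal); Core_ℝ = K_ℝ ∩ {½·1 − ρ ≽ 0}. Claim: [Core_ℝ, 64] ~ [K_ℝ, 29] (IntegralRep
7). Value: LovasAndai2017 Thm 2 (29/64) with Cor 2 (the conditional PPT probability is independent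
of the marginal D; Thm 2 is computed FROM the fibre formula eq. (psep)); hit-and-run MC of the typed
sets 0.4530 ± 0.0021, and 0.4528 ± 0.0021 on the fibre over D = diag(.7,.3), global 9-dim ratio
0.4526 ± 0.0020 (kit j000513). Foreseen chain = LA's proof made semialgebraic (≈ 30 moves): Schur
CoV Z = X^{1/2}C(½−X)^{1/2} (Jacobian det X·det(½−X)); rotation cells diagonalising X
(tan-half-angle chart, Jacobian |ξ₁−ξ₂|, the angular factor [ℝ, 2/(1+t²)] carried as a spectator on
BOTH sides, never integrated out); fibre = B_ℝ ∩ V_εB_ℝV_ε⁻¹ handled by DefectLogRebit (LA Lemma 6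
as a uniform chain, App. A: in the chart (r, w = e^t, ρ, tan φ/2) the conjugation is the scaling w ↦
εw and the volume form is r³); LA p. 8: u = (1−x)/(1+x), (u,v) ↦ (ts, s/t) (rule 2), one integration
by parts (rules 1+3, rati -/
@[route_item "route-KontsevichZagierPeriods-SeparabilityScissors"]
def RebitCore2964 : Prop :=
  ∀ (ρ : (Fin 7 → ℝ) → Matrix (Fin 4) (Fin 4) ℝ), (∀ x, ρ x = !![x 0, x 2, x 3, x 4; x 2, x 1, x 5, x 6; x 3, x 5, 1 / 2 - x 0, -x 2; x 4, x 6, -x 2, 1 / 2 - x 1]) → ∀ (r r' : Literature.NumberTheory.Transcendental.KZ.IntegralRep 7), r.domain = {x | (ρ x).PosSemidef ∧ ((2 : ℝ)⁻¹ • (1 : Matrix (Fin 4) (Fin 4) ℝ) - ρ x).PosSemidef} → Set.EqOn r.integrand (fun _ => 64) r.domain → r'.domain = {x | (ρ x).PosSemidef} → Set.EqOn r'.integrand (fun _ => 29) r'.domain → Literature.NumberTheory.Transcendental.KZ.Equivalent r r'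

/-- item stmt-KontsevichZagierPeriods-8490 · crux · rank 4 · closed · moot by None · by planner
why it might fail: The VALUE identity is conjectural: Slater derived χ̃₂ by CAD on an 11-dim nullified-entry subfamily plus the 8/33 sum rule; his own reduced-family estimate χ̃₂(1/2) ≈ 0.368 ≠ 5/16, planner MC sits at z = +2.4 at ε = 1/2. False at one rational ε ⇒ ¬DefectPoly by soundness.
sources: Slater2018, LovasAndai2017
[crux] SLATER'S DEFECT IDENTITY as a uniform family of 8-dim instances (card E4). B = operator-norm
unit ball of ℂ^{2×2} in real coordinates z ∈ ℝ⁸ (M = [[z0+z1i, z2+z3i],[z4+z5i, z6+z7i]]; ‖M‖ ≤ 1 ⟺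
Tr M*M ≤ 2 ∧ det(1 − M*M) = 1 − Σz² + |det M|² ≥ 0 — polynomial), and for rational ε ∈ (0,1] the
conjugate condition ‖V_ε⁻¹MV_ε‖ ≤ 1, V_ε = diag(1, ε) (entries b ↦ εb, c ↦ c/ε; written ×ε² as
polynomials). Claim: [B ∩ V_εBV_ε⁻¹, 3] ~ [B, ε²(4−ε²)] for every rational 0 < ε ≤ 1, i.e.
Lovas–Andai's χ̃₂(ε) = ε²(4−ε²)/3 with a rules-proof uniform in ε (parameter-as-variable: d/dε of
the moving wall as Newton–Leibniz in ε with a semialgebraic primitive — polynomiality of a period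
function is the one case where a rules-proof is easier than an analytic one). Under it, plan (A) of
QubitCore833 has no transcendental step at all. Value status: CONJECTURAL (Slater2018 eq.
(VerifiedFormula), from cylindrical algebraic decomposition on the 11-dim subfamily with diagonal
D₁, D₂, validated only through the sum rule ∫χ̃₂ dμ = 8/33 — now a theorem — and sampling); planner
MC (kit j000373, 8-dim rejection, 3.2M samples each): χ̃₂(0.5) = 0.3160±0.0015 (formula 0.3125),
χ̃₂(0.7) = 0.5721±0.0016 (0.5733), χ -/
@[route_item "route-KontsevichZagierPeriods-SeparabilityScissors"]
def DefectPoly : Prop :=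
  ∀ ε : ℚ, 0 < ε → ε ≤ 1 → ∀ (r r' : Literature.NumberTheory.Transcendental.KZ.IntegralRep 8), r.domain = {z | (∑ i, z i ^ 2 ≤ 2 ∧ 0 ≤ 1 - ∑ i, z i ^ 2 + (z 0 * z 6 - z 1 * z 7 - z 2 * z 4 + z 3 * z 5) ^ 2 + (z 0 * z 7 + z 1 * z 6 - z 2 * z 5 - z 3 * z 4) ^ 2) ∧ ((ε : ℝ) ^ 2 * (z 0 ^ 2 + z 1 ^ 2) + (ε : ℝ) ^ 4 * (z 2 ^ 2 + z 3 ^ 2) + (z 4 ^ 2 + z 5 ^ 2) + (ε : ℝ) ^ 2 * (z 6 ^ 2 + z 7 ^ 2) ≤ 2 * (ε : ℝ) ^ 2 ∧ 0 ≤ (ε : ℝ) ^ 2 - ((ε : ℝ) ^ 2 * (z 0 ^ 2 + z 1 ^ 2) + (ε : ℝ) ^ 4 * (z 2 ^ 2 + z 3 ^ 2) + (z 4 ^ 2 + z 5 ^ 2) + (ε : ℝ) ^ 2 * (z 6 ^ 2 + z 7 ^ 2)) + (ε : ℝ) ^ 2 * ((z 0 * z 6 - z 1 * z 7 - z 2 *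 z 4 + z 3 * z 5) ^ 2 + (z 0 * z 7 + z 1 * z 6 - z 2 * z 5 - z 3 * z 4) ^ 2))} → Set.EqOn r.integrand (fun _ => 3) r.domain → r'.domain = {z | ∑ i, z i ^ 2 ≤ 2 ∧ 0 ≤ 1 - ∑ i, z i ^ 2 + (z 0 * z 6 - z 1 * z 7 - z 2 * z 4 + z 3 * z 5) ^ 2 + (z 0 * z 7 + z 1 * z 6 - z 2 * z 5 - z 3 * z 4) ^ 2} → Set.EqOn r'.integrand (fun _ => (ε : ℝ) ^ 2 * (4 - (ε : ℝ) ^ 2)) r'.domain → Literature.NumberTheory.Transcendental.KZ.Equivalent r r'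

/-- item stmt-KontsevichZagierPeriods-8491 · crux · rank 5 · closed · moot by None · by planner
why it might fail: Only bookkeeping, but real: a ℚ-semialgebraic Cholesky section over the open Bloch ball, InjOn/HasFDerivWithinAt of (m,x) ↦ (1⊗L(m))ρ₀(x)(1⊗L(m))* on a full-measure cell, its 15×15 Jacobian = det(2m)⁶·(base factor) in Lean, null set of singular marginals.
sources: MilzStrunz2014, LovasAndai2017, KontsevichZagier2001
[crux] MILZ–STRUNZ INVARIANCE AS A CHAIN (card E5): the two fibre instances imply the two global
ones, QubitCore833 → RebitCore2964 → Target. Mechanism: the local filtering (1⊗L)ρ₀(1⊗L)*, L =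
Cholesky factor of 2ρ_B over the open Bloch ball (semialgebraic section), maps base × K bijectively
onto the faithful-marginal part of D (complement null), is linear in ρ₀ with fibre Jacobian |det
L|^{12} = det(2ρ_B)⁶ (complex; |det L|⁷ = det(2ρ_B)^{7/2} real — LovasAndai2017 Thm 1 exponents 4d −
d²/2), preserves ≽ 0 and commutes with Γ on the first factor, so ONE change of variables (rule 2)
turns [P, 33] into [base × Core, 33·J(m)] = [base, J]⋆[Core, 33] and [D, 8] into [base, J]⋆[K, 8];
`KZ.Equivalent.prod` (proved, Literature KZProductIdeal) multiplies the fibre chain by [base, J]. No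
averaging, no singular-value reduction, no χ-function is needed for this step. [deps: QubitCore833,
RebitCore2964] [difficulty: M] -/
@[route_item "route-KontsevichZagierPeriods-SeparabilityScissors"]
def Transport : Prop :=
  QubitCore833 → RebitCore2964 → Target

-- item stmt-KontsevichZagierPeriods-8499 · support · rank 6 · closed · moot by None · by planner — informal only, no Lean statement yet:
--   [crux] SPECTRAL SHELL (plan (B) of QubitCore833; non-abelian Duistermaat–Heckman for the partial
--   trace as moves). E = {ρ ∈ Herm₄(ℂ) : 0 ≼ ρ ≼ ½·1, Tr ρ = 1} (U(4)-invariant, 15-dim in the chart of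
--   Target), b(ρ) = Bloch vector of the second marginal Tr₁ρ = ½(1 + b·σ). Claim to type: for every
--   rational 0 < t < 1/3 the shell E_t = E ∩ {|b| ≤ t} satisfies q_t • [E_t, 1] − p_t • [π]^{⋆6} ∈
--   KZ.relations with p_t/q_t = the rational number c·∫₀^t a²(1−a)⁹(33a³+162a²+72a+8) da
--   (ZhangJiangXie2025 Prop 6.10: f(a) = π⁵/319334400·(1−a)⁹(33a³+162a²+72a+8) = vol_HS of the 12-dim
--   fibre E ∩ {Tr₁ρ = ½(1+aσ₃)},

-- item stmt-KontsevichZagierPeriods-8509 · support · rank 6 · closed · moot by None · by planner — informal only, no Lean statement yet: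
--   x

/-- item stmt-KontsevichZagierPeriods-8492 · support · rank 9 · closed · moot by None · by planner
sources: HorodeckiHorodecki1999, HuongKhoi2024, ZhangJiangXie2025
[support] PPT = CENTRAL REFLECTION ON THE FIBRE (Huong–Khoi's spectral criterion = the reduction
criterion of HorodeckiHorodecki1999 for qubits): for the real 7-dim and complex 12-dim fibre
parametrisations, ρ(x)^Γ ≽ 0 ↔ ½·1 − ρ(x) ≽ 0, because ρ^Γ = (DS)(½·1 − ρ)(DS)ᵀ with S the block
swap and D = diag(1,1,−1,−1) (uses only X + Y = ½·1). Three-line matrix identity +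
`Matrix.PosSemidef` congruence lemmas; links the cores of QubitCore833/RebitCore2964 to the literal
PPT bodies of Target (needed inside Transport). [difficulty: provable-now] -/
@[route_item "route-KontsevichZagierPeriods-SeparabilityScissors"]
def FibreReflection : Prop :=
  (∀ x : Fin 7 → ℝ, (!![x 0, x 2, x 3, x 5; x 2, x 1, x 4, x 6; x 3, x 4, 1 / 2 - x 0, -x 2; x 5, x 6, -x 2, 1 / 2 - x 1] : Matrix (Fin 4) (Fin 4) ℝ).PosSemidef ↔ ((2 : ℝ)⁻¹ • (1 : Matrix (Fin 4) (Fin 4) ℝ) - !![x 0, x 2, x 3, x 4; x 2, x 1, x 5, x 6; x 3, x 5, 1 / 2 - x 0, -x 2; x 4, x 6, -x 2, 1 / 2 - x 1]).PosSemidef) ∧ (open scoped ComplexOrder in ∀ x : Fin 12 → ℝ, (!![((x 0 : ℝ) : ℂ), (⟨x 2, x 3⟩ : ℂ), (⟨x 4, -x 5⟩ : ℂ), (⟨x 8, -x 9⟩ : ℂ); (⟨x 2, -x 3⟩ : ℂ), ((x 1 : ℝ) : ℂ), (⟨x 6, -x 7⟩ : ℂ), (⟨x 10, -x 11⟩ :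 ℂ); (⟨x 4, x 5⟩ : ℂ), (⟨x 6, x 7⟩ : ℂ), ((1 / 2 - x 0 : ℝ) : ℂ), (⟨-x 2, -x 3⟩ : ℂ); (⟨x 8, x 9⟩ : ℂ), (⟨x 10, x 11⟩ : ℂ), (⟨-x 2, x 3⟩ : ℂ), ((1 / 2 - x 1 : ℝ) : ℂ)] : Matrix (Fin 4) (Fin 4) ℂ).PosSemidef ↔ ((2 : ℂ)⁻¹ • (1 : Matrix (Fin 4) (Fin 4) ℂ) - !![((x 0 : ℝ) : ℂ), (⟨x 2, x 3⟩ : ℂ), (⟨x 4, x 5⟩ : ℂ), (⟨x 6, x 7⟩ : ℂ); (⟨x 2, -x 3⟩ : ℂ), ((x 1 : ℝ) : ℂ), (⟨x 8, x 9⟩ : ℂ), (⟨x 10, x 11⟩ : ℂ); (⟨x 4, -x 5⟩ : ℂ), (⟨x 8, -x 9⟩ : ℂ), ((1 / 2 - x 0 : ℝ) : ℂ), (⟨-x 2, -x 3⟩ : ℂ); (⟨x 6, -x 7⟩ : ℂ), (⟨x 10, -x 11⟩ : ℂ), (⟨-x 2, x 3⟩ : ℂ), ((1 / 2 - x 1 :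 ℝ) : ℂ)]).PosSemidef)

/-- item stmt-KontsevichZagierPeriods-8493 · support · rank 9 · closed · moot by None · by planner
sources: KontsevichZagier2001, LovasAndai2017, HuongKhoi2024
[support] LOGICAL POSITION: KontsevichZagierPeriods → (64·vol P_ℝ = 29·vol D_ℝ, stated as value
equality of the two typed 9-dim representations) → (33·vol P_ℂ = 8·vol D_ℂ, likewise in dimension
15) → Target. Constant integrands are IsRational (p = C a, q = 1), so each conjunct of Target is an
instance of the summit; refuting a conjunct by a genuine non-derivability proof refutes the summit.
The two value hypotheses are LovasAndai2017 Thm 2 and HuongKhoi2024 (cite-facts requested).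
[difficulty: provable-now] -/
@[route_item "route-KontsevichZagierPeriods-SeparabilityScissors"]
def SectorOfSummit : Prop :=
  KontsevichZagierPeriods → (∀ (ρ ρ' : (Fin 9 → ℝ) → Matrix (Fin 4) (Fin 4) ℝ), (∀ y, ρ y = !![y 0, y 2, y 5, y 6; y 2, y 1, y 7, y 8; y 5, y 7, y 3, y 4; y 6, y 8, y 4, 1 - y 0 - y 1 - y 3]) → (∀ y, ρ' y = !![y 0, y 2, y 5, y 7; y 2, y 1, y 6, y 8; y 5, y 6, y 3, y 4; y 7, y 8, y 4, 1 - y 0 - y 1 - y 3]) → ∀ (r r' : Literature.NumberTheory.Transcendental.KZ.IntegralRep 9), r.domain = {y | (ρ y).PosSemidef ∧ (ρ' y).PosSemidef} → Set.EqOn r.integrand (fun _ => 64) r.domain → r'.domain = {y | (ρ y).PosSemidef} → Set.EqOn r'.integrand (fun _ => 29) r'.domain → r.value = r'.value) → (open scoped ComplexOrder in ∀ (ρ ρ' : (Fin 15 → ℝ) → Matrix (Fin 4) (Fin 4) ℂ), (∀ y, ρ y = !![((y 0 : ℝ) : ℂ), (⟨y 2, y 3⟩ : ℂ), (⟨y 7,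 y 8⟩ : ℂ), (⟨y 9, y 10⟩ : ℂ); (⟨y 2, -y 3⟩ : ℂ), ((y 1 : ℝ) : ℂ), (⟨y 11, y 12⟩ : ℂ), (⟨y 13, y 14⟩ : ℂ); (⟨y 7, -y 8⟩ : ℂ), (⟨y 11, -y 12⟩ : ℂ), ((y 4 : ℝ) : ℂ), (⟨y 5, y 6⟩ : ℂ); (⟨y 9, -y 10⟩ : ℂ), (⟨y 13, -y 14⟩ : ℂ), (⟨y 5, -y 6⟩ : ℂ), ((1 - y 0 - y 1 - y 4 : ℝ) : ℂ)]) → (∀ y, ρ' y = !![((y 0 : ℝ) : ℂ), (⟨y 2, y 3⟩ : ℂ), (⟨y 7, -y 8⟩ : ℂ), (⟨y 11, -y 12⟩ : ℂ); (⟨y 2, -y 3⟩ : ℂ), ((y 1 : ℝ) : ℂ), (⟨y 9, -y 10⟩ : ℂ), (⟨y 13, -y 14⟩ : ℂ); (⟨y 7, y 8⟩ : ℂ), (⟨y 9, y 10⟩ : ℂ), ((y 4 : ℝ) : ℂ), (⟨y 5, y 6⟩ : ℂ); (⟨y 11, y 12⟩ : ℂ), (⟨y 13, y 14⟩ : ℂ),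 (⟨y 5, -y 6⟩ : ℂ), ((1 - y 0 - y 1 - y 4 : ℝ) : ℂ)]) → ∀ (r r' : Literature.NumberTheory.Transcendental.KZ.IntegralRep 15), r.domain = {y | (ρ y).PosSemidef ∧ (ρ' y).PosSemidef} → Set.EqOn r.integrand (fun _ => 33) r.domain → r'.domain = {y | (ρ y).PosSemidef} → Set.EqOn r'.integrand (fun _ => 8) r'.domain → r.value = r'.value) → Target

/-- item stmt-KontsevichZagierPeriods-8494 · support · rank 9 · closed · moot by None · by planner
sources: LovasAndai2017, Slater2018
[support] LOVAS–ANDAI LEMMA 6 AS A UNIFORM CHAIN (first brick of RebitCore2964): for rational 0 < ε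
≤ 1, [B_ℝ ∩ V_εB_ℝV_ε⁻¹, 3] (IntegralRep 4; B_ℝ = {z : Σz² ≤ 2, 1 − Σz² + (z0z3 − z1z2)² ≥ 0} the
operator-norm ball of ℝ^{2×2}) ~ the 2-dim rational representation [{0 < t < s < ε}, 8((s²+1)/s³ −
(s²−1)²/(s³(1−t²)))] (log((1+s)/(1−s)) unfolded as ∫₀^s 2dt/(1−t²)); value 3χ₁(ε) = 8∫₀^ε (s + 1/s −
½(s−1/s)² log((1+s)/(1−s))) ds/s (χ₁(1) = 2π²/3; LovasAndai2017 Lemma 6 + Table 2, PROVED there,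
App. A; planner MC χ̃₁(0.5) = 0.5312 ± 0.0004 = Simpson of Lemma 6, kit j000373). Chain: LA's App. A
atlas X = rY±(t,ρ,φ) with w = e^t, u = tan(φ/2) is semialgebraic, the similarity by Λ_δ is the
scaling w ↦ e^{−δ}w, √det g = r³ (NL in r, primitive r⁴/4), the comparison ‖Y(t−δ)‖ > ‖Y(t)‖ ⟺ t <
δ/2 is a semialgebraic cell split, and the (ρ,φ)-integrals of p. 15 have rational primitives up to
the one log kept as a variable. [difficulty: M] -/
@[route_item "route-KontsevichZagierPeriods-SeparabilityScissors"]
def DefectLogRebit : Prop :=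
  ∀ ε : ℚ, 0 < ε → ε ≤ 1 → ∀ (r : Literature.NumberTheory.Transcendental.KZ.IntegralRep 4) (r' : Literature.NumberTheory.Transcendental.KZ.IntegralRep 2), r.domain = {z | (∑ i, z i ^ 2 ≤ 2 ∧ 0 ≤ 1 - ∑ i, z i ^ 2 + (z 0 * z 3 - z 1 * z 2) ^ 2) ∧ ((ε : ℝ) ^ 2 * z 0 ^ 2 + (ε : ℝ) ^ 4 * z 1 ^ 2 + z 2 ^ 2 + (ε : ℝ) ^ 2 * z 3 ^ 2 ≤ 2 * (ε : ℝ) ^ 2 ∧ 0 ≤ (ε : ℝ) ^ 2 - ((ε : ℝ) ^ 2 * z 0 ^ 2 + (ε : ℝ) ^ 4 * z 1 ^ 2 + z 2 ^ 2 + (ε : ℝ) ^ 2 * z 3 ^ 2) + (ε : ℝ) ^ 2 * (z 0 * z 3 - z 1 * z 2) ^ 2)} → Set.EqOn r.integrand (fun _ => 3) r.domain → r'.domain = {w | 0 < w 1 ∧ w 1 < w 0 ∧ w 0 < (ε : ℝ)} → Set.EqOn r'.integrand (fun w => 8 * ((w 0 ^ 2 + 1) / w 0 ^ 3 - (w 0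 ^ 2 - 1) ^ 2 / (w 0 ^ 3 * (1 - w 1 ^ 2)))) r'.domain → Literature.NumberTheory.Transcendental.KZ.Equivalent r r'

/-- item stmt-KontsevichZagierPeriods-8495 · support · rank 9 · closed · moot by None · by planner
sources: Slater2018, MilzStrunz2014
[support] X-STATES CALIBRATION (toy rung, provable now): two-qubit X-states ρ =
[[a,0,0,w],[0,b,z,0],[0,z̄,c,0],[w̄,0,0,d]], a+b+c+d = 1, form the 7-dim body D_X = {a,b,c,d ≥ 0,
|w|² ≤ ad, |z|² ≤ bc}; PPT_X = D_X ∩ {|w|² ≤ bc, |z|² ≤ ad}. Claim [PPT_X, 5] ~ [D_X, 2]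
(Dunkl–Slater 2015: HS separability probability of X-states = 2/5, reproduced in Slater2018 §;
planner check E[min(ad,bc)²]/E[abcd] = 0.40003, kit j000504). Chain: disc fibres w = √(ad)·u (rule
2, Jacobian ad) make both sides [Δ-cells, polynomial]⋆[disc]⋆[disc]; split Δ along ad = bc (c =
a(1−a−b)/(a+b), rational); iterated Newton–Leibniz with polynomial/rational primitives down to
dimension 0 on each side (values 2/5040 both) and back. Exercises exactly the
disc-fibre/product/min-cell bookkeeping of the big bodies. [difficulty: provable-now] -/
@[route_item "route-KontsevichZagierPeriods-SeparabilityScissors"]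
def XStates25 : Prop :=
  ∀ (r r' : Literature.NumberTheory.Transcendental.KZ.IntegralRep 7), r.domain = {y | (0 ≤ y 0 ∧ 0 ≤ y 1 ∧ 0 ≤ y 2 ∧ 0 ≤ 1 - y 0 - y 1 - y 2 ∧ y 3 ^ 2 + y 4 ^ 2 ≤ y 0 * (1 - y 0 - y 1 - y 2) ∧ y 5 ^ 2 + y 6 ^ 2 ≤ y 1 * y 2) ∧ (y 3 ^ 2 + y 4 ^ 2 ≤ y 1 * y 2 ∧ y 5 ^ 2 + y 6 ^ 2 ≤ y 0 * (1 - y 0 - y 1 - y 2))} → Set.EqOn r.integrand (fun _ => 5) r.domain → r'.domain = {y | 0 ≤ y 0 ∧ 0 ≤ y 1 ∧ 0 ≤ y 2 ∧ 0 ≤ 1 - y 0 - y 1 - y 2 ∧ y 3 ^ 2 + y 4 ^ 2 ≤ y 0 * (1 - y 0 - y 1 - y 2) ∧ y 5 ^ 2 + y 6 ^ 2 ≤ y 1 * y 2} → Set.EqOn r'.integrand (fun _ => 2) r'.domain → Literature.NumberTheory.Transcendental.KZ.Equivalent r r'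

/-- item stmt-KontsevichZagierPeriods-8496 · assembly · rank 1 · closed · moot by None · by planner
sources: KontsevichZagier2001, LovasAndai2017
[assembly] QubitCore833 → RebitCore2964 → Transport → Target. -/
@[route_item "route-KontsevichZagierPeriods-SeparabilityScissors"]
def Assembly : Prop :=
  QubitCore833 → RebitCore2964 → Transport → Target

end Summit.KontsevichZagierPeriods.KontsevichZagierPeriods.Theses.SeparabilityScissors
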